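import Summits.QuantumFields.YangMills.Theorems.BalabanUVNodesN12ForestSliceLeftField
import Literature.MathematicalPhysics.QuantumFieldTheory.Balaban1983to89.B15Prop1RightInverseFromForestLeftField
import Literature.MathematicalPhysics.QuantumFieldTheory.Balaban1983to89.B15Prop1MinimiserFamilyFromThm1AtBaseCentral
import HarnessLib

/-!
# BalabanUVNodes ∕ N12 — THE (45) LETTER `hR` OF THE w1 LINEAGE's (J0′) CHART THEOREM, FROM dag-n12-w3's FOREST-SLICE LEFT-FIELD RIGHT INVERSE AT A CURVED BASE FIELD
# ([Balaban1985Variational] Sect. C (44)–(48) p. 285, (82)–(83) p. 290; [Balaban1985RegularSpaces] (1.19) p. 79)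

Cell `pub-ymgap` (HUMAN RULINGS D-0062 ∕ D-0149), WIDTH SEAT `pub-ymgap-dag-n12-w1` g3 (node N12 = [B15]; key K1⁹ `stmt-QuantumFields-27364`, `--kind proof --supports … --as helper`; count-neutral).
THEOREMS ONLY (0 `def`, 0 `instance`, 0 `sorry`); consumed BY NAME: dag-n12-w3 g3's `N12ForestSliceLeftField.exists_forest_leftField_of_surjective_curved_of_agreeOn` (p6262xx) and this
seat's `B15Prop1RightInverseFromForestLeftField.hR_of_forest_leftField` (the `𝔰𝔲(2) = {Σ_a y_a E_a}` coordinate dictionary).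

WHY.  The lineage's best theorem `B15Prop1LinearisedKernelDictionary.hMin_atRecord_of_node00Letters` ∕ its Theorem-1-at-the-base edition
`B15Prop1MinimiserFamilyFromThm1AtBase.hMin_atRecord_of_node00Letters_thm1AtBase` display, per base field, the (45) letter `hR`: a right inverse FROM THE SLICE `S` of NODE 00's
linearised multi-scale averaging `Q(U₀)` in left-field `ℝ³`-coordinate currency.  With `S` the axial slice (F3) of a rooted forest, dag-n12-w3's theorem supplies exactly that right
inverse in `𝔰𝔲(2)` currency at every guarded CURVED base field `U₀`, from (F1), the roots, and the surjectivity of `DΦ_{U₀}(0)` on the whole space (dag-n10-w1's letter,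
hypothesis-free near the flat configuration).  THIS FILE is the one-application junction: (45) `hR` for the forest slice ⟸ {(F1), roots ⊇ block-tower sites of the constrained
bonds, (F3), guards `PlaqSmall t₀ (Ū^i U₀)` (`i < k`), `stokesConst·t₀ < δ_2`, `DΦ_{U₀}(0)` onto} (`hR_forest_of_surjective_curved`), and the lineage's best theorem with
(45) so discharged (`hMin_atRecord_of_node00Letters_thm1AtBase_central_surj`).

HONEST FRAMING.  Bookkeeping (coordinates of `𝔰𝔲(2)`); the surjectivity of `DΦ_{U₀}(0)` stays DISPLAYED; nothing of Bałaban's estimates asserted; N12 NOT discharged; K1⁹ NOT closed;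
counts unmoved; one finite 𝕋⁴ programme at fixed ε — R4 closes the conditional rung `BalabanLadder.UV` only; the Yang–Mills mass gap (Clay) is NOT proved by any of this; nothing
continuum ∕ ℝ⁴ ∕ OS.
-/

noncomputable section

namespace Summit.QuantumFields.YangMills.BalabanUVNodes.N12RightInverseLetterOfForest

open scoped BigOperators Matrix.Norms.L2Operator Topology
open Literature.MathematicalPhysics.QuantumFieldTheory.Balaban1983to89
open T4Continuum
open B15DeterminingSets GaugeField
open ExpMeanLog (expMeanLogSU deltaSU)
open T4AdjointCovarianceUnitary (lieSU)
open Node00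
open B15SU2ChartHolomorphic (genE)
open B15Prop1AnalyticExtClause (cplxVec)
open B15Prop1ChartCalculusSU2 (E3)
open T4CubeChartGnomonic (SU2)
open Summit.QuantumFields.YangMills.Theorems.BlockAvgCorrector (stokesConst)
open Summit.QuantumFields.YangMills.BalabanUVNodes.N12ForestSliceLeftField (exists_forest_leftField_of_surjective_curved_of_agreeOn)
open Literature.MathematicalPhysics.QuantumFieldTheory.Balaban1983to89.B15Prop1RightInverseFromForestLeftField (hR_of_forest_leftField)
open Literature.MathematicalPhysics.QuantumFieldTheory.Balaban1983to89.B15Prop1MinimiserFamilyFromThm1AtBaseCentral (hMin_atRecord_of_node00Letters_thm1AtBase_central)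
open Literature.MathematicalPhysics.QuantumFieldTheory.BalabanImbrieJaffe1984to88.BIJ85Eq453GaugeField (qsstarGIter0)
open B15AveragingHolomorphic (iterMh)
open B15SU2ChartHolomorphic (expMulC logCoordC)
open B15ShellGauge193 (shellGauge)
open B15Extension193 (extend)
open B16Sect1Backgrounds (toMS expMul)
open B15Prop1ChartSU2 (su2Chart)
open Metric (ball)

variable {F : T4Family} {K k : ℕ}

/-- ★★★ **THE (45) LETTER `hR` FOR THE FOREST SLICE AT A CURVED GUARDED BASE FIELD** — the binder `hR` of `hMin_atRecord_of_node00Letters[_thm1AtBase]` (left-field `ℝ³`-coordinate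
currency, slice `S` = the axial slice (F3) of a rooted forest with (F1) and roots at the block-tower sites of the constrained bonds of `𝐁`) ⟸ dag-n12-w3's forest-slice left-field right
inverse at `U₀` (guards `PlaqSmall t₀ (Ū^i U₀)`, `i < k`, `stokesConst·t₀ < δ_2`; datum `W` on the fibre of `U₀`) and the DISPLAYED surjectivity of `DΦ_{U₀}(0)` (NODE 00's real chart
`msChart`). [cite: Balaban1985Variational, Sect. C (44)–(48) p.285, (82)–(83) p.290; Balaban1985RegularSpaces, (1.19) p.79; Balaban1989LargeFieldII, (1.19) p.360] -/
theorem hR_forest_of_surjective_curved (𝔹 : DetSet (F.P K)) (hk : k ≤ (F.P K).m + (F.P K).K)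
    {t₀ : ℝ} (ht₀ : 0 < t₀) (hstδ : stokesConst (F.P K) * t₀ < deltaSU (Fin 2))
    {U₀ : GaugeField (F.P K) 0 SU2} (hsm : ∀ i, i < k → PlaqSmall t₀ (Averaging.iter (avOfRecord F 2 K) i U₀))
    {W : MSField (F.P K) SU2} (hW : AgreeOn 𝔹 (avgFamily (avOfRecord F 2 K) U₀) W)
    (S : Submodule ℂ (VecField (F.P K) 0 (EuclideanSpace ℂ (Fin 3))))
    {path : Site (F.P K) 0 → List (LStep (F.P K) 0)}
    (hroot : ∀ r ∈ {z : Site (F.P K) 0 | ∃ j, j ≤ k ∧ ∃ c ∈ bondsOf (𝔹 j), (z = embIter j c.src ∨ z = embIter j c.tgt)}, path r = [])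
    (hF1 : ∀ x, ∀ s ∈ path x, ∃ x' x'' : Site (F.P K) 0, path x'' = path x' ++ [s] ∧
      (s.fwd = true → s.bond.src = x' ∧ s.bond.tgt = x'') ∧ (s.fwd = false → s.bond.src = x'' ∧ s.bond.tgt = x'))
    (hF3 : ∀ X : VecField (F.P K) 0 (EuclideanSpace ℂ (Fin 3)), X ∈ S ↔ ∀ x, ∀ s ∈ path x, X s.bond = 0)
    -- DISPLAYED: the linearised constraint at `U₀` is onto (dag-n10-w1's letter)
    (hsurj : Function.Surjective (fderiv ℝ (msChart F 2 K k 𝔹 (avgFamily (avOfRecord F 2 K) U₀) U₀) 0)) :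
    ∀ τ : Fin (constrCard 𝔹 k) → EuclideanSpace ℝ (Fin 3), ∃ p : VecField (F.P K) 0 E3, cplxVec p ∈ S ∧
      ∀ i : Fin (constrCard 𝔹 k), dIterL ((constrEnum 𝔹 k).symm i).1 (coeField U₀)
        (fun b => (∑ a : Fin 3, ((p b a : ℝ) : ℂ) • genE a) * ((U₀ b : SU2) : Matrix (Fin 2) (Fin 2) ℂ)) ((constrEnum 𝔹 k).symm i).2.1 =
        ((W ((constrEnum 𝔹 k).symm i).1 ((constrEnum 𝔹 k).symm i).2.1 : SU2) : Matrix (Fin 2) (Fin 2) ℂ) * ∑ b : Fin 3, ((τ i b : ℝ) : ℂ) • genE b :=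
  hR_of_forest_leftField 𝔹 k W U₀ S path hF3 fun y =>
    exists_forest_leftField_of_surjective_curved_of_agreeOn 𝔹 hk ht₀ hstδ hsm hW hroot hF1 hsurj y


/-- ★★★ **THE LINEAGE's BEST THEOREM WITH (45) DISCHARGED BY THE FOREST RIGHT INVERSE** — `B15Prop1MinimiserFamilyFromThm1AtBaseCentral.hMin_atRecord_of_node00Letters_thm1AtBase_central` with the
(45) conjunct `hR` of `hbase` REPLACED by dag-n12-w3's guards (`∃ t₀ > 0, stokesConst·t₀ < δ_2 ∧ ∀ i < k, PlaqSmall t₀ (Ū^i U₀)`) and the DISPLAYED surjectivity of `DΦ_{U₀}(0)` (NODE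
00's real chart `msChart` at the datum `Ū(U₀)`; dag-n10-w1 ∕ dag-n12-w3's letter, hypothesis-free near the flat configuration), via `hR_forest_of_surjective_curved` on the forest the
base field's `hbase` names.  Per base field the displayed letters are then: minimiser `U₀` + guards, forest (F1)(F2)(F3), `DΦ_{U₀}(0)` onto, (β) `hposN`, (T1@q₀); plus the class facts
and `k ≤ m + K`. [cite: Balaban1985Variational, Thm 1 p.279, (3)–(4) p.278, (16)–(18) p.280, Sect. C (44)–(48) p.285, (82)–(83) p.290, Prop. 8 p.305, Sect. G pp.305–307, Prop. 9 (190) p.309; Balaban1985RegularSpaces, (1.19) p.79; Balaban1989LargeFieldI, (1.74) p.192, Prop. 1 p.194; Balaban1989LargeFieldII, (1.9) p.358, (1.12) p.359; Balaban1988Convergent, (2.10)–(2.12) p.256] -/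
theorem hMin_atRecord_of_node00Letters_thm1AtBase_central_surj (ν : Node00.Stage7Numerics) (Kt kc : ℕ) (Ω : ℕ → Set (Site (F.P Kt) 0))
    (Λ : Set (Site (F.P Kt) k)) (lo hi : Fin (F.P Kt).d → ℤ) (𝔹 : DetSet (F.P Kt)) (h𝔹 : ∀ j, k < j → 𝔹 j = ∅) (hk : k ≤ (F.P Kt).m + (F.P Kt).K)
    (ext : GaugeField (F.P Kt) k SU2 → GaugeField (F.P Kt) k SU2) (hext : ∀ W, ext W = extend Λ (shellGauge W lo hi) W)
    {K : Set (GaugeField (F.P Kt) k SU2)} (hK : IsCompact K) {𝓐₀ : ℝ} (h𝓐₀ : 1 < 𝓐₀)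
    -- the three CLASS facts: a closed-reading class `reg'` containing the closure of NODE 00's class, on which the `𝐁`-restricted averages are continuous
    (reg' : Set (GaugeField (F.P Kt) 0 SU2)) (hreg' : IsClosed reg') (hcl : closure (Node00.regMSCoPOfRecord F 2 ν Kt kc Ω) ⊆ reg')
    (hDreg' : ContinuousOn (fun (U : GaugeField (F.P Kt) 0 SU2) (i : Fin (constrCard 𝔹 k)) =>
      ((avgFamily (Node00.avOfRecord F 2 Kt) U ((constrEnum 𝔹 k).symm i).1 ((constrEnum 𝔹 k).symm i).2.1 : SU2) : Matrix (Fin 2) (Fin 2) ℂ)) reg')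
    (hbase : ∀ Vk ∈ K, ∃ (U₀ : GaugeField (F.P Kt) 0 SU2) (S : Submodule ℂ (VecField (F.P Kt) 0 (EuclideanSpace ℂ (Fin 3)))) (path : Site (F.P Kt) 0 → List (LStep (F.P Kt) 0))
        (a : S → ℂ) (Φ₀ : S → Fin (constrCard 𝔹 k) → EuclideanSpace ℂ (Fin 3)),
      IsMinimizer (Node00.avOfRecord F 2 Kt) (Node00.regMSCoPOfRecord F 2 ν Kt kc Ω) 𝔹
        (avgFamily (Node00.avOfRecord F 2 Kt) (qsstarGIter0 k (ext Vk))) U₀ ∧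
      SmallBelow (Node00.avOfRecord F 2 Kt) k (qsstarGIter0 k (ext Vk)) ∧
      SmallBelow (Node00.avOfRecord F 2 Kt) k U₀ ∧
      -- the slice is the axial slice of a rooted forest: (F1), (F2), (F3)
      (∀ x, ∀ s ∈ path x, ∃ x' x'' : Site (F.P Kt) 0, path x'' = path x' ++ [s] ∧
        (s.fwd = true → s.bond.src = x' ∧ s.bond.tgt = x'') ∧ (s.fwd = false → s.bond.src = x'' ∧ s.bond.tgt = x')) ∧
      (∀ j, j ≤ k → ∀ c ∈ bondsOf (𝔹 j), path (embIter j c.src) = [] ∧ path (embIter j c.tgt) = []) ∧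
      (∀ X : VecField (F.P Kt) 0 (EuclideanSpace ℂ (Fin 3)), X ∈ S ↔ ∀ x, ∀ s ∈ path x, X s.bond = 0) ∧
      (∀ X : S, a X = ∑ p : Plaq (F.P Kt) 0, (1 - (expMulC (X : VecField (F.P Kt) 0 (EuclideanSpace ℂ (Fin 3))) (coeField U₀) ⟨p.src, p.μ⟩ *
        expMulC (X : VecField (F.P Kt) 0 (EuclideanSpace ℂ (Fin 3))) (coeField U₀) ⟨p.src.shift p.μ, p.ν⟩ *
        Matrix.adjugate (expMulC (X : VecField (F.P Kt) 0 (EuclideanSpace ℂ (Fin 3))) (coeField U₀) ⟨p.src.shift p.ν, p.μ⟩) *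
        Matrix.adjugate (expMulC (X : VecField (F.P Kt) 0 (EuclideanSpace ℂ (Fin 3))) (coeField U₀) ⟨p.src, p.ν⟩)).trace / 2)) ∧
      (∀ (X : S) i, Φ₀ X i = logCoordC (star ((avgFamily (Node00.avOfRecord F 2 Kt) (qsstarGIter0 k (ext Vk))
        ((constrEnum 𝔹 k).symm i).1 ((constrEnum 𝔹 k).symm i).2.1 : SU2) : Matrix (Fin 2) (Fin 2) ℂ) *
        iterMh ((constrEnum 𝔹 k).symm i).1 (expMulC (X : VecField (F.P Kt) 0 (EuclideanSpace ℂ (Fin 3))) (coeField U₀)) ((constrEnum 𝔹 k).symm i).2.1)) ∧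
      -- guards in dag-n12-w3's currency and the DISPLAYED surjectivity of `DΦ_{U₀}(0)` (dag-n10-w1 ∕ dag-n12-w3's letter; hypothesis-free near the flat configuration)
      (∃ t₀ : ℝ, 0 < t₀ ∧ stokesConst (F.P Kt) * t₀ < deltaSU (Fin 2) ∧ ∀ i, i < k → PlaqSmall t₀ (Averaging.iter (Node00.avOfRecord F 2 Kt) i U₀)) ∧
      Function.Surjective (fderiv ℝ (Node00.msChart F 2 Kt k 𝔹 (avgFamily (Node00.avOfRecord F 2 Kt) U₀) U₀) 0) ∧
      -- DISPLAYED ((β), REAL currency, kernel in `Q(U₀)` currency): positivity of the real second variation of the Lagrangian on the real kernel of the linearised averaging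
      (∀ ℓ₀ : (Fin (constrCard 𝔹 k) → EuclideanSpace ℂ (Fin 3)) →L[ℂ] ℂ, fderiv ℂ a 0 = ℓ₀.comp (fderiv ℂ Φ₀ 0) →
        ∀ (p : VecField (F.P Kt) 0 E3) (hp : cplxVec p ∈ S), p ≠ 0 →
          (∀ i : Fin (constrCard 𝔹 k), dIterL ((constrEnum 𝔹 k).symm i).1 (coeField U₀)
            (fun b => (∑ a : Fin 3, ((p b a : ℝ) : ℂ) • genE a) * ((U₀ b : SU2) : Matrix (Fin 2) (Fin 2) ℂ)) ((constrEnum 𝔹 k).symm i).2.1 = 0) →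
          0 < deriv (deriv (fun t : ℝ => wilsonAction4 (expMul su2Chart (t • p) U₀) - (ℓ₀ (Φ₀ ((t : ℂ) • ⟨cplxVec p, hp⟩))).re)) 0) ∧
      -- DISPLAYED (T1@q₀): Theorem 1 at the base datum — the DATUM-PRESERVING (central at the 𝐁-towers) orbit of `U₀` is the unique minimal orbit over `reg'`
      (∀ U ∈ reg', AgreeOn 𝔹 (avgFamily (Node00.avOfRecord F 2 Kt) U) (avgFamily (Node00.avOfRecord F 2 Kt) (qsstarGIter0 k (ext Vk))) →
        wilsonAction4 U ≤ wilsonAction4 U₀ →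
          ∃ u : GaugeTransf (F.P Kt) 0 SU2, (∀ j, j ≤ k → ∀ b ∈ bondsOf (𝔹 j), toMS u j b.src = toMS u j b.tgt ∧ ∀ g : SU2, toMS u j b.src * g = g * toMS u j b.src) ∧ gaugeAct u U = U₀)) :
    ∃ R : ℝ, 0 < R ∧ ∀ Vk ∈ K,
      ∃ Ũ : VecField (F.P Kt) k (EuclideanSpace ℂ (Fin 3)) × VecField (F.P Kt) k (EuclideanSpace ℂ (Fin 3)) → PBond (F.P Kt) 0 → Matrix (Fin 2) (Fin 2) ℂ,
        (∀ b i j, DifferentiableOn ℂ (fun z => Ũ z b i j) (ball 0 R)) ∧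
        (∀ z ∈ ball (0 : VecField (F.P Kt) k (EuclideanSpace ℂ (Fin 3)) × VecField (F.P Kt) k (EuclideanSpace ℂ (Fin 3))) R, ∀ b i j, ‖Ũ z b i j‖ ≤ 𝓐₀) ∧
        ∀ p B' : VecField (F.P Kt) k E3, ‖p‖ < R → ‖B'‖ < R → ∃ U' : GaugeField (F.P Kt) 0 SU2,
          (∀ b, Ũ (cplxVec p, cplxVec B') b = ((U' b : SU2) : Matrix (Fin 2) (Fin 2) ℂ)) ∧
            IsMinimizer (Node00.avOfRecord F 2 Kt) (Node00.regMSCoPOfRecord F 2 ν Kt kc Ω) 𝔹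
              (avgFamily (Node00.avOfRecord F 2 Kt) (qsstarGIter0 k (expMul su2Chart B' (ext (expMul su2Chart p Vk))))) U' :=
  hMin_atRecord_of_node00Letters_thm1AtBase_central ν Kt kc Ω Λ lo hi 𝔹 h𝔹 hk ext hext hK h𝓐₀ reg' hreg' hcl hDreg'
    (fun Vk hVk => by
      obtain ⟨U₀, S, path, a, Φ₀, hmin, hsbQ, hsbU, hF1, hF2, hF3, ha, hΦ₀, ⟨t₀, ht₀, hstδ, hsm⟩, hsurj, hposN, hT1⟩ := hbase Vk hVk
      have hroot : ∀ r ∈ {z : Site (F.P Kt) 0 | ∃ j, j ≤ k ∧ ∃ c ∈ bondsOf (𝔹 j), (z = embIter j c.src ∨ z = embIter j c.tgt)}, path r = [] := by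
        rintro r ⟨j, hj, c, hc, hr | hr⟩
        · rw [hr]; exact (hF2 j hj c hc).1
        · rw [hr]; exact (hF2 j hj c hc).2
      exact ⟨U₀, S, path, a, Φ₀, hmin, hsbQ, hsbU, hF1, hF2, hF3, ha, hΦ₀,
        hR_forest_of_surjective_curved 𝔹 hk ht₀ hstδ hsm hmin.2.1 S hroot hF1 hF3 hsurj, hposN, hT1⟩)

end Summit.QuantumFields.YangMills.BalabanUVNodes.N12RightInverseLetterOfForest

end
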